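import Literature.AnabelianGeometry.SemiGraphs.TieLabels
import Literature.AnabelianGeometry.SemiGraphs.FiniteEtaleCoveringConnectedProofs

/-!
# Every closed family of components is met by a canonical label ([SemiAnbd] Def. 2.2 (i) p. 23)

Mochizuki, *Semi-graphs of anabelioids*, Publ. RIMS **42** (2006) 221–322, §2, Def. 2.2 (i) p. 23 (the
finite étale covering `ℋ → 𝒦` attached to `A ∈ B(𝒦)`: its vertices / edges over `v` / `e` "correspond to
the connected components of `S_v`" / `T_e`) [cite: MochizukiSemiAnbd2006, Def. 2.2(i) p.23].

PROOF-ONLY (abc-iut cell, layer L3; FACT-LIST row F-1478 `remark_2_4_1_covering`, residual GAP-LEDGER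
G-w5d041-g4-1 «tie WITHOUT connectedness»; seat abc-iut-f-161).  The one place where abc-iut-f-161's tie
`Hom.tie_bijective` used connectedness of `ℋ` and `𝒦` was the degree count on a connected `𝔾_A`.  The
global input that replaces it, valid for ARBITRARY `ℋ`, `𝒦`:

* `BObj.exists_subobject_of_closedFamily` — a family of connected components `K_V(u) ⊆ π₀(A_u)`,
  `K_E(e) ⊆ π₀(A_e)` CLOSED under "the component under" (`Q ∈ K_E(e) ↔ componentOver_b Q ∈ K_V(v)` for
  `b ∈ e` abutting to `v`) is the family of components of a sub-object `Z ↪ A` of `B(𝒦)` (abc-iut-L6-d5's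
  (D8) construction `FiniteEtaleCoveringConnectedProofs`, with the key identity read directly on `𝔾_A`);
* `Hom.exists_label_mem_of_closedFamily` — **for `ψ : ℋ → 𝒦` with a global witness
  `αψ : B(𝒦)_{/A} ⥲ B(ℋ)`, `e_ψ : ψ^* ≅ (A × −) ⋙ αψ`, every NONEMPTY closed family contains a canonical
  label**: the constituent `g_w` (or `g_{e′}`) of the tautological section `g = αψ(η_{𝟙_A}) ≫ e_ψ⁻¹_A`
  factors through `ψ_w^*(P ↪ A_u)` for some `P ∈ K_V(ψ w)` (or the edge twin).  Proof: `αψ(Z → A)` is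
  non-initial (`αψ` is an equivalence, `Z` has a non-empty fibre), so one of its constituents is
  non-initial; the naturality square `αψ(Z → A) → ψ^*Z → ψ^*A = αψ(Z → A) → αψ(𝟙_A) →g ψ^*A` read on a
  fibre puts the global base point inside the fibre-image of `Z`.

Consumer: `TieBijectiveGeneral` (the tie, hence F-1478, without connectedness hypotheses).  No `def`,
no new `Prop`; nothing here takes a side on [IUTchIII] Cor. 3.12.
-/

namespace Literature.AnabelianGeometry.SemiGraphs

namespace SemiGraphOfAnabelioids

open CategoryTheory CategoryTheory.Limits CategoryTheory.PreGaloisCategory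
open Literature.AnabelianGeometry.Anabelioids

universe v₁ u₁ u

/-! ### Part 1. The sub-object of `A` cut out by a closed family of components -/

namespace BObj

variable {𝒦 : SemiGraphOfAnabelioids.{v₁, u₁, u}} (A : 𝒦.BObj)

/-- Membership in a fibre-image transported along an isomorphism `ψ : Y ≅ T` (bookkeeping, as in
abc-iut-L6-d5's (D8) proof). [folklore] -/
private theorem mem_range_comp_iso_iff {C : Type u₁} [Category.{v₁} C] (F : C ⥤ FintypeCat.{v₁})
    {X Y T : C} (g : X ⟶ Y) (ψ : Y ≅ T) (x : F.obj T) :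
    x ∈ Set.range (F.map (g ≫ ψ.hom)) ↔ F.map ψ.inv x ∈ Set.range (F.map g) := by
  have hw : ∀ w, F.map ψ.inv (F.map ψ.hom w) = w := fun w =>
    FintypeCat.hom_inv_id_apply (F.mapIso ψ) w
  have hw' : ∀ w, F.map ψ.hom (F.map ψ.inv w) = w := fun w =>
    FintypeCat.inv_hom_id_apply (F.mapIso ψ) w
  constructor
  · rintro ⟨z, rfl⟩
    exact ⟨z, by rw [Functor.map_comp, FintypeCat.comp_apply, hw]⟩
  · rintro ⟨z, hz⟩
    exact ⟨z, by rw [Functor.map_comp, FintypeCat.comp_apply, hz, hw']⟩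

/-- **The key identity along a branch.**  For a family of components closed under "the component
under" and a branch `b ∈ e` abutting to `v`: a point of the fibre of `T_e` lies under `ψ_b(b^* P)` for
some selected `P ⊆ S_v` iff it lies in some selected `Q ⊆ T_e` (the component `Q` through the point has
`componentOver_b Q = P`, abc-iut-L6-t18 `componentOver_eq_of_mem`; conversely `Q ⊆ ψ_b(b^* P)` for `P`
the component under `Q`). [cite: MochizukiSemiAnbd2006, Def. 2.2(i) p.23] -/
theorem closedFamily_range_iff (KV : ∀ u, Set (π₀Obj (A.S u))) (KE : ∀ e, Set (π₀Obj (A.T e)))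
    (hcl : ∀ (b : 𝒦.graph.Branch) (u : 𝒦.graph.Vertex) (h : 𝒦.graph.abuts b = some u)
      (Q : π₀Obj (A.T (𝒦.graph.edgeOf b))), Q ∈ KE (𝒦.graph.edgeOf b) ↔ A.componentOver b u h Q ∈ KV u)
    (b : 𝒦.graph.Branch) (v : 𝒦.graph.Vertex) (h : 𝒦.graph.abuts b = some v)
    (Fe : 𝒦.E (𝒦.graph.edgeOf b) ⥤ FintypeCat.{v₁}) [FiberFunctor Fe]
    (x : Fe.obj (A.T (𝒦.graph.edgeOf b))) :
    (∃ P ∈ KV v, x ∈ Set.range (Fe.map ((𝒦.pull b v h).pullback.map P.1.arrow ≫ (A.ψ b v h).hom))) ↔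
      ∃ Q ∈ KE (𝒦.graph.edgeOf b), x ∈ Set.range (Fe.map Q.1.arrow) := by
  let F' : 𝒦.V v ⥤ FintypeCat.{v₁} := (𝒦.pull b v h).pullback ⋙ Fe
  haveI : FiberFunctor F' := fiberFunctor_comp_of_exact _ _
  obtain ⟨Q₀, hQ₀x⟩ := exists_component_mem_range Fe x
  constructor
  · rintro ⟨P, hP, z, hz⟩
    have hP' : A.componentOver b v h Q₀ = P := by
      refine componentOver_eq_of_mem A F' b h Fe (Iso.refl F') (x := F'.map P.1.arrow z) ?_ ⟨z, rfl⟩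
      have hx : Fe.map (A.ψ b v h).hom (F'.map P.1.arrow z) = x := by
        rw [← hz, Functor.map_comp, FintypeCat.comp_apply]
        rfl
      rw [Iso.refl_inv, NatTrans.id_app, FintypeCat.id_apply, hx]
      exact hQ₀x
    exact ⟨Q₀, (hcl b v h Q₀).mpr (hP' ▸ hP), hQ₀x⟩
  · rintro ⟨Q, hQ, q, rfl⟩
    refine ⟨A.componentOver b v h Q, (hcl b v h Q).mp hQ, ?_⟩
    have hle := A.le_branchImage_componentOver b v h Q
    haveI := A.mono_map_arrow_comp_ψ b v h (A.componentOver b v h Q).1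
    have hmk : Set.range (Fe.map (A.branchImage b v h (A.componentOver b v h Q).1).arrow) =
        Set.range (Fe.map ((𝒦.pull b v h).pullback.map (A.componentOver b v h Q).1.arrow ≫
          (A.ψ b v h).hom)) := by
      rw [BObj.branchImage, range_map_mk_arrow Fe]
    rw [← hmk]
    refine ⟨Fe.map (Subobject.ofLE _ _ hle) q, ?_⟩
    rw [← FintypeCat.comp_apply, ← Fe.map_comp, Subobject.ofLE_arrow]

/-- **The sub-object of `A` cut out by a closed family of components** (abc-iut-L6-d5's (D8)
construction, for the covering `𝔾_A` itself): given components `K_V(u) ⊆ π₀(A_u)`, `K_E(e) ⊆ π₀(A_e)`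
closed under "the component under", there is a monomorphism `m : Z ↪ A` of `B(𝒦)` whose fibre-image at
every vertex `u` (edge `e`), for every basepoint, is the union of the fibre-images of the selected
components: the disjoint unions `Z_u = ∐_{P ∈ K_V(u)} P`, `Z_e = ∐_{Q ∈ K_E(e)} Q` glue along every
branch by `closedFamily_range_iff`. [cite: MochizukiSemiAnbd2006, Def. 2.2(i) p.23] -/
theorem exists_subobject_of_closedFamily (KV : ∀ u, Set (π₀Obj (A.S u)))
    (KE : ∀ e, Set (π₀Obj (A.T e)))
    (hcl : ∀ (b : 𝒦.graph.Branch) (u : 𝒦.graph.Vertex) (h : 𝒦.graph.abuts b = some u)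
      (Q : π₀Obj (A.T (𝒦.graph.edgeOf b))), Q ∈ KE (𝒦.graph.edgeOf b) ↔ A.componentOver b u h Q ∈ KV u) :
    ∃ (Z : 𝒦.BObj) (m : Z ⟶ A), Mono m ∧
      (∀ (u : 𝒦.graph.Vertex) (F : 𝒦.V u ⥤ FintypeCat.{v₁}) [FiberFunctor F] (y : F.obj (A.S u)),
        y ∈ Set.range (F.map (m.fS u)) ↔ ∃ P ∈ KV u, y ∈ Set.range (F.map P.1.arrow)) ∧
      ∀ (e : 𝒦.graph.Edge) (F : 𝒦.E e ⥤ FintypeCat.{v₁}) [FiberFunctor F] (y : F.obj (A.T e)),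
        y ∈ Set.range (F.map (m.fT e)) ↔ ∃ Q ∈ KE e, y ∈ Set.range (F.map Q.1.arrow) := by
  classical
  -- fibre functors of the constituents of `𝒦`
  let FV : ∀ v : 𝒦.graph.Vertex, 𝒦.V v ⥤ FintypeCat.{v₁} := fun v =>
    GaloisCategory.getFiberFunctor (𝒦.V v)
  let FE : ∀ e : 𝒦.graph.Edge, 𝒦.E e ⥤ FintypeCat.{v₁} := fun e =>
    GaloisCategory.getFiberFunctor (𝒦.E e)
  -- index the selected components by finite types
  have hreV : ∀ v, ∃ n : ℕ, Nonempty (KV v ≃ Fin n) := fun v => by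
    haveI : Finite (π₀Obj (A.S v)) := finite_connectedSubobject _
    exact Finite.exists_equiv_fin _
  have hreE : ∀ e, ∃ n : ℕ, Nonempty (KE e ≃ Fin n) := fun e => by
    haveI : Finite (π₀Obj (A.T e)) := finite_connectedSubobject _
    exact Finite.exists_equiv_fin _
  choose nV εV using hreV
  choose nE εE using hreE
  let ιV : ∀ v, Fin (nV v) → π₀Obj (A.S v) := fun v i => ((εV v).some.symm i).1
  let ιE : ∀ e, Fin (nE e) → π₀Obj (A.T e) := fun e i => ((εE e).some.symm i).1
  have hιV_mem : ∀ v i, ιV v i ∈ KV v := fun v i => ((εV v).some.symm i).2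
  have hιE_mem : ∀ e i, ιE e i ∈ KE e := fun e i => ((εE e).some.symm i).2
  have hιV_surj : ∀ v (P : π₀Obj (A.S v)), P ∈ KV v → ∃ i, ιV v i = P := fun v P hP =>
    ⟨(εV v).some ⟨P, hP⟩, by simp [ιV]⟩
  have hιE_surj : ∀ e (Q : π₀Obj (A.T e)), Q ∈ KE e → ∃ i, ιE e i = Q := fun e Q hQ =>
    ⟨(εE e).some ⟨Q, hQ⟩, by simp [ιE]⟩
  have hιV_inj : ∀ v, Function.Injective (ιV v) := fun v i j hij =>
    (εV v).some.symm.injective (Subtype.ext hij)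
  have hιE_inj : ∀ e, Function.Injective (ιE e) := fun e i j hij =>
    (εE e).some.symm.injective (Subtype.ext hij)
  -- the constituents of `Z` and the components of `m`
  let ZS : ∀ v, 𝒦.V v := fun v => ∐ fun i : Fin (nV v) => ((ιV v i).1 : 𝒦.V v)
  let ZT : ∀ e, 𝒦.E e := fun e => ∐ fun i : Fin (nE e) => ((ιE e i).1 : 𝒦.E e)
  let mS : ∀ v, ZS v ⟶ A.S v := fun v => Sigma.desc fun i => (ιV v i).1.arrow
  let mT : ∀ e, ZT e ⟶ A.T e := fun e => Sigma.desc fun i => (ιE e i).1.arrow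
  have hrangeS : ∀ (v) (F : 𝒦.V v ⥤ FintypeCat.{v₁}) [FiberFunctor F] (y : F.obj (A.S v)),
      y ∈ Set.range (F.map (mS v)) ↔ ∃ P ∈ KV v, y ∈ Set.range (F.map P.1.arrow) := by
    intro v F _ y
    change y ∈ Set.range (F.map (Sigma.desc fun i => (ιV v i).1.arrow)) ↔ _
    rw [range_map_sigmaDesc, Set.mem_iUnion]
    exact ⟨fun ⟨i, hi⟩ => ⟨ιV v i, hιV_mem v i, hi⟩, fun ⟨P, hP, hy⟩ => by
      obtain ⟨i, rfl⟩ := hιV_surj v P hP; exact ⟨i, hy⟩⟩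
  have hrangeT : ∀ (e) (F : 𝒦.E e ⥤ FintypeCat.{v₁}) [FiberFunctor F] (y : F.obj (A.T e)),
      y ∈ Set.range (F.map (mT e)) ↔ ∃ Q ∈ KE e, y ∈ Set.range (F.map Q.1.arrow) := by
    intro e F _ y
    change y ∈ Set.range (F.map (Sigma.desc fun i => (ιE e i).1.arrow)) ↔ _
    rw [range_map_sigmaDesc, Set.mem_iUnion]
    exact ⟨fun ⟨i, hi⟩ => ⟨ιE e i, hιE_mem e i, hi⟩, fun ⟨Q, hQ, hy⟩ => by
      obtain ⟨i, rfl⟩ := hιE_surj e Q hQ; exact ⟨i, hy⟩⟩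
  haveI hmS : ∀ v, Mono (mS v) := fun v =>
    mono_sigmaDesc_of_pairwise_disjoint (FV v) _ fun i j hij =>
      Set.disjoint_left.mpr fun y hyi hyj =>
        hij (hιV_inj v (component_eq_of_mem_range (FV v) _ _ hyi hyj))
  haveI hmT : ∀ e, Mono (mT e) := fun e =>
    mono_sigmaDesc_of_pairwise_disjoint (FE e) _ fun i j hij =>
      Set.disjoint_left.mpr fun y hyi hyj =>
        hij (hιE_inj e (component_eq_of_mem_range (FE e) _ _ hyi hyj))
  -- the gluing: fibre-images agree along every branch, by the key identity
  have hψrange : ∀ (b : 𝒦.graph.Branch) (v : 𝒦.graph.Vertex) (h : 𝒦.graph.abuts b = some v),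
      Set.range ((FE _).map ((𝒦.pull b v h).pullback.map (mS v) ≫ (A.ψ b v h).hom)) =
        Set.range ((FE _).map (mT (𝒦.graph.edgeOf b))) := by
    intro b v h
    let F' : 𝒦.V v ⥤ FintypeCat.{v₁} := (𝒦.pull b v h).pullback ⋙ FE (𝒦.graph.edgeOf b)
    haveI : FiberFunctor F' := fiberFunctor_comp_of_exact _ _
    ext x
    rw [mem_range_comp_iso_iff, hrangeT]
    have h1 : (FE _).map (A.ψ b v h).inv x ∈
        Set.range ((FE _).map ((𝒦.pull b v h).pullback.map (mS v))) ↔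
          ∃ P ∈ KV v, (FE _).map (A.ψ b v h).inv x ∈ Set.range (F'.map P.1.arrow) :=
      hrangeS v F' _
    refine h1.trans ?_
    rw [← A.closedFamily_range_iff KV KE hcl b v h (FE _) x]
    refine exists_congr fun P => and_congr_right fun _ => ?_
    exact (mem_range_comp_iso_iff (FE _) ((𝒦.pull b v h).pullback.map P.1.arrow) (A.ψ b v h) x).symm
  have hψex : ∀ (b : 𝒦.graph.Branch) (v : 𝒦.graph.Vertex) (h : 𝒦.graph.abuts b = some v),
      ∃ ε : (𝒦.pull b v h).pullback.obj (ZS v) ≅ ZT (𝒦.graph.edgeOf b),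
        ε.hom ≫ mT _ = (𝒦.pull b v h).pullback.map (mS v) ≫ (A.ψ b v h).hom :=
    fun b v h => exists_iso_of_range_eq (FE _) _ _ (hψrange b v h)
  choose Zψ hZψ using hψex
  let Z : 𝒦.BObj := { S := ZS, T := ZT, ψ := Zψ }
  let m : Z ⟶ A := { fS := mS, fT := mT, comm := fun b v h => (hZψ b v h).symm }
  haveI : Mono m := mono_of_components m (fun v => hmS v) fun e => hmT e
  exact ⟨Z, m, this, fun u F _ y => hrangeS u F y, fun e F _ y => hrangeT e F y⟩

end BObj

/-! ### Part 2. A nonempty closed family is met by a canonical label -/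

namespace Hom

variable {ℋ 𝒦 : SemiGraphOfAnabelioids.{v₁, u₁, u}} (ψ : Hom ℋ 𝒦) (A : 𝒦.BObj)
  [HasBinaryProducts 𝒦.BObj] (αψ : Over A ⥤ ℋ.BObj) [αψ.IsEquivalence]
  (eψ : ψ.pullbackFunctor ≅ Over.star A ⋙ αψ)

omit [αψ.IsEquivalence] in
set_option backward.isDefEq.respectTransparency false in
/-- **The naturality square of a sub-object.**  For `m : Z ⟶ A` in `B(𝒦)`, the morphisms
`αψ(η_{(Z,m)}) ≫ e_ψ⁻¹_Z : αψ(Z, m) ⟶ ψ^* Z` and `g = αψ(η_{𝟙_A}) ≫ e_ψ⁻¹_A : αψ 𝟙_A ⟶ ψ^* A` fit into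
the commutative square `αψ(Z, m) → ψ^*Z →ψ^*m ψ^*A = αψ(Z, m) → αψ 𝟙_A →g ψ^*A` (naturality of the unit of
`forget ⊣ star` and of `e_ψ`). [cite: MochizukiSemiAnbd2006, Def. 2.2(i) p.23] -/
theorem section_square {Z : 𝒦.BObj} (m : Z ⟶ A) :
    (αψ.map ((Over.forgetAdjStar A).unit.app (Over.mk m)) ≫ eψ.inv.app Z) ≫
        ψ.pullbackFunctor.map m =
      αψ.map (Over.homMk m (Category.comp_id m) : Over.mk m ⟶ Over.mk (𝟙 A)) ≫
        (αψ.map ((Over.forgetAdjStar A).unit.app (Over.mk (𝟙 A))) ≫ eψ.inv.app A) := by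
  have h1 := eψ.inv.naturality m
  have hnat : (Over.homMk m (Category.comp_id m) : Over.mk m ⟶ Over.mk (𝟙 A)) ≫
      (Over.forgetAdjStar A).unit.app (Over.mk (𝟙 A)) =
        (Over.forgetAdjStar A).unit.app (Over.mk m) ≫ (Over.star A).map m :=
    (Over.forgetAdjStar A).unit.naturality _
  calc (αψ.map ((Over.forgetAdjStar A).unit.app (Over.mk m)) ≫ eψ.inv.app Z) ≫
          ψ.pullbackFunctor.map m
        = αψ.map ((Over.forgetAdjStar A).unit.app (Over.mk m)) ≫
            ((Over.star A ⋙ αψ).map m ≫ eψ.inv.app A) := by rw [Category.assoc, h1]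
      _ = αψ.map ((Over.forgetAdjStar A).unit.app (Over.mk m) ≫ (Over.star A).map m) ≫
            eψ.inv.app A := by rw [Functor.comp_map, Functor.map_comp, Category.assoc]
      _ = αψ.map ((Over.homMk m (Category.comp_id m) : Over.mk m ⟶ Over.mk (𝟙 A)) ≫
            (Over.forgetAdjStar A).unit.app (Over.mk (𝟙 A))) ≫ eψ.inv.app A := by rw [hnat]
      _ = _ := by rw [Functor.map_comp, Category.assoc]

set_option backward.isDefEq.respectTransparency false in
/-- **The image of a sub-object is non-initial.**  For a monomorphism-or-not `m : Z ⟶ A` whose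
fibre-images contain those of a NONEMPTY family of components, the object `αψ(Z, m)` of `B(ℋ)` has a
non-initial vertex or edge constituent (`αψ` is an equivalence and `Z` is non-initial; `forget ⊣ star`
makes `forget` preserve the initial object; initial objects of `B(−)` have initial constituents).
[cite: MochizukiSemiAnbd2006, Def. 2.2(i) p.23] -/
theorem exists_not_isInitial_constituent {Z : 𝒦.BObj} (m : Z ⟶ A)
    (KV : ∀ u, Set (π₀Obj (A.S u))) (KE : ∀ e, Set (π₀Obj (A.T e)))
    (hZS : ∀ (u : 𝒦.graph.Vertex) (F : 𝒦.V u ⥤ FintypeCat.{v₁}) [FiberFunctor F] (y : F.obj (A.S u)),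
      y ∈ Set.range (F.map (m.fS u)) ↔ ∃ P ∈ KV u, y ∈ Set.range (F.map P.1.arrow))
    (hZT : ∀ (e : 𝒦.graph.Edge) (F : 𝒦.E e ⥤ FintypeCat.{v₁}) [FiberFunctor F] (y : F.obj (A.T e)),
      y ∈ Set.range (F.map (m.fT e)) ↔ ∃ Q ∈ KE e, y ∈ Set.range (F.map Q.1.arrow))
    (hne : (∃ u P, P ∈ KV u) ∨ (∃ e Q, Q ∈ KE e)) :
    (∃ w, IsInitial ((αψ.obj (Over.mk m)).S w) → False) ∨
      ∃ e', IsInitial ((αψ.obj (Over.mk m)).T e') → False := by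
  by_contra hcon
  have hS : ∀ w, Nonempty (IsInitial ((αψ.obj (Over.mk m)).S w)) := fun w => by
    by_contra hw
    exact hcon (Or.inl ⟨w, fun hi => hw ⟨hi⟩⟩)
  have hT : ∀ e', Nonempty (IsInitial ((αψ.obj (Over.mk m)).T e')) := fun e' => by
    by_contra he
    exact hcon (Or.inr ⟨e', fun hi => he ⟨hi⟩⟩)
  have hX : IsInitial (αψ.obj (Over.mk m)) :=
    ((αψ.obj (Over.mk m)).nonempty_isInitial_of_components hS hT).some
  -- `(Z, m)` is initial in `Over A`, hence `Z` is initial in `B(𝒦)`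
  have hM : IsInitial (Over.mk m : Over A) :=
    (hX.isInitialObj αψ.inv _).ofIso (αψ.asEquivalence.unitIso.app (Over.mk m)).symm
  haveI := (Over.forgetAdjStar A).leftAdjoint_preservesColimits
  have hZ : IsInitial Z := hM.isInitialObj (Over.forget A) (Over.mk m)
  -- but `Z` has a non-empty fibre at a selected component
  obtain ⟨-, hρ, hρE⟩ := hasColimitsOfShape_bObj (𝒢 := 𝒦) (J := Discrete PEmpty.{1})
  rcases hne with ⟨u, P, hP⟩ | ⟨e, Q, hQ⟩
  · haveI := hρ u
    let F := GaloisCategory.getFiberFunctor (𝒦.V u)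
    have hinit : IsInitial (Z.S u) := hZ.isInitialObj (𝒦.ρ u) Z
    haveI : IsEmpty (F.obj (Z.S u)) := (initial_iff_fiber_empty F _).mp ⟨hinit⟩
    haveI : PreGaloisCategory.IsConnected (P.1 : 𝒦.V u) := P.2
    obtain ⟨p⟩ := nonempty_fiber_of_isConnected F (P.1 : 𝒦.V u)
    obtain ⟨z, -⟩ := (hZS u F (F.map P.1.arrow p)).mpr ⟨P, hP, p, rfl⟩
    exact IsEmpty.false z
  · haveI := hρE e
    let F := GaloisCategory.getFiberFunctor (𝒦.E e)
    have hinit : IsInitial (Z.T e) := hZ.isInitialObj (𝒦.ρE e) Z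
    haveI : IsEmpty (F.obj (Z.T e)) := (initial_iff_fiber_empty F _).mp ⟨hinit⟩
    haveI : PreGaloisCategory.IsConnected (Q.1 : 𝒦.E e) := Q.2
    obtain ⟨q⟩ := nonempty_fiber_of_isConnected F (Q.1 : 𝒦.E e)
    obtain ⟨z, -⟩ := (hZT e F (F.map Q.1.arrow q)).mpr ⟨Q, hQ, q, rfl⟩
    exact IsEmpty.false z

set_option backward.isDefEq.respectTransparency false in
/-- **Every nonempty closed family of components contains a canonical label** (no connectedness
hypothesis on `ℋ` or `𝒦`).  Let `ψ : ℋ → 𝒦` carry a global witness `αψ : B(𝒦)_{/A} ⥲ B(ℋ)`,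
`e_ψ : ψ^* ≅ (A × −) ⋙ αψ`, and let `K_V(u) ⊆ π₀(A_u)`, `K_E(e) ⊆ π₀(A_e)` be a family of components closed
under "the component under" and nonempty.  Then for some vertex `w` of `ℋ` the constituent `g_w` of the
tautological section `g = αψ(η_{𝟙_A}) ≫ e_ψ⁻¹_A : αψ 𝟙_A ⟶ ψ^*A` factors through `ψ_w^*(P ↪ A_{ψ w})` for
some SELECTED `P ∈ K_V(ψ w)` — i.e. the canonical label `O(w)` is selected — or the edge twin holds.
(The family is the family of components of a sub-object `Z ↪ A`; `αψ(Z → A)` has a non-initial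
constituent, and the section square read on its fibre puts the global base point in the fibre-image
of `Z`.) [cite: MochizukiSemiAnbd2006, Def. 2.2(i) p.23] -/
theorem exists_label_mem_of_closedFamily (KV : ∀ u, Set (π₀Obj (A.S u)))
    (KE : ∀ e, Set (π₀Obj (A.T e)))
    (hcl : ∀ (b : 𝒦.graph.Branch) (u : 𝒦.graph.Vertex) (h : 𝒦.graph.abuts b = some u)
      (Q : π₀Obj (A.T (𝒦.graph.edgeOf b))), Q ∈ KE (𝒦.graph.edgeOf b) ↔ A.componentOver b u h Q ∈ KV u)
    (hne : (∃ u P, P ∈ KV u) ∨ (∃ e Q, Q ∈ KE e)) :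
    (∃ (w : ℋ.graph.Vertex) (P : π₀Obj (A.S (ψ.base.vertexMap w))), P ∈ KV (ψ.base.vertexMap w) ∧
      ∃ k : (αψ.obj (Over.mk (𝟙 A))).S w ⟶
          (ψ.φV w).pullback.obj (P.1 : 𝒦.V (ψ.base.vertexMap w)),
        k ≫ (ψ.φV w).pullback.map P.1.arrow =
          (αψ.map ((Over.forgetAdjStar A).unit.app (Over.mk (𝟙 A))) ≫ eψ.inv.app A).fS w) ∨
    ∃ (e' : ℋ.graph.Edge) (Q : π₀Obj (A.T (ψ.base.edgeMap e'))), Q ∈ KE (ψ.base.edgeMap e') ∧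
      ∃ k : (αψ.obj (Over.mk (𝟙 A))).T e' ⟶
          (ψ.φE e' (ψ.base.edgeMap e') rfl).pullback.obj (Q.1 : 𝒦.E (ψ.base.edgeMap e')),
        k ≫ (ψ.φE e' (ψ.base.edgeMap e') rfl).pullback.map Q.1.arrow =
          (αψ.map ((Over.forgetAdjStar A).unit.app (Over.mk (𝟙 A))) ≫ eψ.inv.app A).fT e' := by
  classical
  obtain ⟨Z, m, -, hZS, hZT⟩ := A.exists_subobject_of_closedFamily KV KE hcl
  have hsq := section_square ψ A αψ eψ m
  rcases exists_not_isInitial_constituent A αψ m KV KE hZS hZT hne with ⟨w, hw⟩ | ⟨e', he'⟩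
  · -- a non-initial VERTEX constituent of `αψ(Z, m)`
    left
    let F' := GaloisCategory.getFiberFunctor (ℋ.V w)
    let F : 𝒦.V (ψ.base.vertexMap w) ⥤ FintypeCat.{v₁} := (ψ.φV w).pullback ⋙ F'
    haveI : FiberFunctor F := fiberFunctor_comp_of_exact _ F'
    obtain ⟨x⟩ := (not_initial_iff_fiber_nonempty F' ((αψ.obj (Over.mk m)).S w)).mp hw
    -- the section square, read on the fibre `F′` at the point `x`
    have hsqw : F'.map ((ψ.φV w).pullback.map (m.fS (ψ.base.vertexMap w)))
        (F'.map ((eψ.inv.app Z).fS w)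
          (F'.map ((αψ.map ((Over.forgetAdjStar A).unit.app (Over.mk m))).fS w) x)) =
        F'.map ((eψ.inv.app A).fS w)
          (F'.map ((αψ.map ((Over.forgetAdjStar A).unit.app (Over.mk (𝟙 A)))).fS w)
            (F'.map ((αψ.map (Over.homMk m (Category.comp_id m) : Over.mk m ⟶ Over.mk (𝟙 A))).fS w)
              x)) := by
      have := congrArg (fun f => F'.map (BObj.Hom.fS f w) x) hsq
      simp only [BObj.comp_fS, pullbackFunctor_map_fS, F'.map_comp, FintypeCat.comp_apply] at this
      exact this
    -- the global base point lies in the fibre-image of `Z`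
    have hy : F'.map ((αψ.map ((Over.forgetAdjStar A).unit.app (Over.mk (𝟙 A))) ≫ eψ.inv.app A).fS w)
        (F'.map ((αψ.map (Over.homMk m (Category.comp_id m) : Over.mk m ⟶ Over.mk (𝟙 A))).fS w) x) ∈
        Set.range (F.map (m.fS (ψ.base.vertexMap w))) := by
      refine ⟨F'.map ((eψ.inv.app Z).fS w)
        (F'.map ((αψ.map ((Over.forgetAdjStar A).unit.app (Over.mk m))).fS w) x), ?_⟩
      rw [BObj.comp_fS, F'.map_comp, FintypeCat.comp_apply]
      exact hsqw
    obtain ⟨P, hP, hyP⟩ := (hZS _ F _).mp hy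
    exact ⟨w, P, hP, (section_factors_iff_mem_range ψ A αψ eψ w F' _ P).mpr hyP⟩
  · -- a non-initial EDGE constituent of `αψ(Z, m)`
    right
    let F' := GaloisCategory.getFiberFunctor (ℋ.E e')
    let F : 𝒦.E (ψ.base.edgeMap e') ⥤ FintypeCat.{v₁} :=
      (ψ.φE e' (ψ.base.edgeMap e') rfl).pullback ⋙ F'
    haveI : FiberFunctor F := fiberFunctor_comp_of_exact _ F'
    obtain ⟨x⟩ := (not_initial_iff_fiber_nonempty F' ((αψ.obj (Over.mk m)).T e')).mp he'
    have hsqe : F'.map ((ψ.φE e' (ψ.base.edgeMap e') rfl).pullback.map (m.fT (ψ.base.edgeMap e')))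
        (F'.map ((eψ.inv.app Z).fT e')
          (F'.map ((αψ.map ((Over.forgetAdjStar A).unit.app (Over.mk m))).fT e') x)) =
        F'.map ((eψ.inv.app A).fT e')
          (F'.map ((αψ.map ((Over.forgetAdjStar A).unit.app (Over.mk (𝟙 A)))).fT e')
            (F'.map ((αψ.map (Over.homMk m (Category.comp_id m) : Over.mk m ⟶ Over.mk (𝟙 A))).fT e')
              x)) := by
      have := congrArg (fun f => F'.map (BObj.Hom.fT f e') x) hsq
      simp only [BObj.comp_fT, pullbackFunctor_map_fT, F'.map_comp, FintypeCat.comp_apply] at this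
      exact this
    have hy : F'.map ((αψ.map ((Over.forgetAdjStar A).unit.app (Over.mk (𝟙 A))) ≫ eψ.inv.app A).fT e')
        (F'.map ((αψ.map (Over.homMk m (Category.comp_id m) : Over.mk m ⟶ Over.mk (𝟙 A))).fT e') x) ∈
        Set.range (F.map (m.fT (ψ.base.edgeMap e'))) := by
      refine ⟨F'.map ((eψ.inv.app Z).fT e')
        (F'.map ((αψ.map ((Over.forgetAdjStar A).unit.app (Over.mk m))).fT e') x), ?_⟩
      rw [BObj.comp_fT, F'.map_comp, FintypeCat.comp_apply]
      exact hsqe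
    obtain ⟨Q, hQ, hyQ⟩ := (hZT _ F _).mp hy
    exact ⟨e', Q, hQ, (sectionE_factors_iff_mem_range ψ A αψ eψ e' F' _ Q).mpr hyQ⟩

end Hom

end SemiGraphOfAnabelioids

end Literature.AnabelianGeometry.SemiGraphs
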